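import Literature.NumberTheory.Automorphic.PairLFunctionPolesProofs
import Literature.NumberTheory.Automorphic.GLOneStandardLTate
import Literature.NumberTheory.Automorphic.AutomorphicQuotientErgodic
import Literature.NumberTheory.Automorphic.AdelicSecondCountable
import Literature.NumberTheory.Automorphic.AdelicGroupDataGLOneProofs
import Literature.NumberTheory.GaloisRepresentations.HeckeCharacterNormCharacter
import HarnessLib

/-!
# Arthur–Clozel (2.2) at `s = 1` for `GL_1`: reduction to Hecke `L`-functions (proofs only)

Topic `NumberTheory/Automorphic`; namespace `Literature.NumberTheory.Automorphic`. Proof file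
(theorems only: no definition, no named fact, no instance) under the named fact
`JacquetShalika1981_partialPairL_at_one_of_ne_conj` of `PairLFunctionPoles` — Arthur–Clozel,
*Simple algebras, base change, and the advanced theory of the trace formula*, Ann. of Math.
Stud. 120 (1989), Ch. 3 §2, (2.2), p. 171, at `s₀ = 1`: for unitary cuspidal `π`, `σ` on
`GL_n(𝔸_K)` with `π ≇ σ̃`, `L^S(s, π ⊗ σ)` has a finite **non-zero** limit as `s → 1`, `Re s > 1`
("cf. [Jacquet–Shalika II, Prop. 3.6]. The non-vanishing part of these results is due to
Shahidi") — in the **rank `n = 1`**, where the statement is classical: a cuspidal automorphic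
representation of `GL_1(𝔸_K)` is a unitary idele class character `χ` trivial on `A_G = ℝ_{>0}`
(Tate, *Fourier analysis in number fields and Hecke's zeta-functions* (1950), §4;
Jacquet–Langlands, LNM 114, §9, §12), `L^S(s, χ × χ') = L^S(s, χχ')` is a partial Hecke
`L`-function, `σ̃ = σ̄ = χ'⁻¹`, so `π ≇ σ̃` means `ψ := χχ' ≠ 1`, and (2.2) at `s = 1` is Hecke's
continuation of `L(s, ψ)` to `s = 1` (Hecke (1920); Tate (1950), Thm. 4.4.1) together with the
non-vanishing `L(1, ψ) ≠ 0` (Hecke (1920), Landau; for `K = ℚ` Dirichlet (1837)).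

Everything here is **proved**; the file reduces the `n = 1` case of the named fact, over any
number field `K`, to that classical statement about Hecke characters, spelled out as an explicit
hypothesis (not vendored as a fact, D-0026):

* `GLOne.eigenvalue_eq_heckeCharacter_det` — in `GL_1(R)` every element is the scalar matrix of
  its determinant (`generalLinearGroup_scalar_det_of_fin_one` of `AdelicGroupDataGLOneProofs`), so
  the eigencharacter `ω_W` of an irreducible `W ≤ L²(GL_1(K) A_G \ GL_1(𝔸_K))` is read off from
  its Hecke character `χ_W`;
* `GLOne.eq_of_heckeCharacter_eq`, `CuspidalAutomorphicRepGL.eq_of_heckeCharacter_eq` —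
  **multiplicity one for `GL_1`, unconditionally**: two irreducible closed invariant subspaces of
  `L²` with the same Hecke character coincide. Proof by ergodicity of `GL_1(𝔸_K)` on the
  automorphic quotient (`AutomorphicQuotientErgodic`: a `χ`-eigenfunction orthogonal to a
  non-zero `χ`-eigenfunction vanishes), as in Gelbart, *Automorphic forms on adele groups*
  (1975), proof of Thm. 10.10; so the hypothesis `multiplicity_one_gl 1 K μ` of the fact is not
  used in rank one;
* `GLOne.eigenvalue_conj`, `CuspidalAutomorphicRepGL.heckeCharacter_conj` — **the conjugate
  `π̄` (`AutomorphicConjugate`, realising `π̃`) has Hecke character `χ̄_π = χ_π⁻¹`**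
  (`R(g) f̄ = \overline{R(g) f}`, and `|χ_π| = 1`);
* `CuspidalAutomorphicRepGL.heckeCharacter_posRealIdele` — `χ_π` is trivial on `A_G = ℝ_{>0}`
  (the quotient is by `A_G · GL_1(K)`, outline D10);
* `eval_satakePairPolynomial_singleton`, `HeckeCharacter.valueAtUniformizer_mul`,
  `HeckeCharacter.IsUnramifiedAt.mul`, `CuspidalAutomorphicRepGL.partialPairL_eq_tprod_heckeCharacter`
  — **`L^S(s, π × π') = L^S(s, χ_π χ_{π'}) = ∏'_{v ∉ S} (1 - (χ_π χ_{π'})(ϖ_v) q_v^{-s})⁻¹`** for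
  honest Satake families of cuspidal `π, π' : GL_1` off `S` (the GL_1 dictionary
  `IsSatakeFamilyOf.eq_singleton_valueAtUniformizer` of `GLOneStandardLTate`);
* `JacquetShalika1981_partialPairL_at_one_of_ne_conj_one_of_heckeCharacter` — **the reduction**:
  if for every unitary Hecke character `ψ ≠ 1` of `K` trivial on `A_G` and every finite `S` off
  which `ψ` is unramified the partial Hecke `L`-function `L^S(s, ψ)` has a finite non-zero limit
  as `s → 1`, `Re s > 1` (Hecke–Landau), then
  `JacquetShalika1981_partialPairL_at_one_of_ne_conj` holds for `n = 1` over `K`. The sibling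
  `PairLFunctionPolesGLOneRatProofs` discharges the hypothesis for `K = ℚ` from Mathlib's
  Dirichlet `L`-functions.

## References

* J. Arthur, L. Clozel, *Simple algebras, base change, and the advanced theory of the trace
  formula*, Ann. of Math. Stud. 120 (1989), Ch. 3 §2, (2.2), p. 171. [ArthurClozelAMS120]
* J. Tate, *Fourier analysis in number fields and Hecke's zeta-functions* (1950), in
  Cassels–Fröhlich, *Algebraic Number Theory* (1967), Ch. XV, §4, Thm. 4.4.1. [TateThesis1967]
* S. Gelbart, *Automorphic forms on adele groups*, Ann. of Math. Stud. 83 (1975), §2 and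
  Thm. 10.10. [Gelbart1975]
* E. Hecke, *Eine neue Art von Zetafunktionen und ihre Beziehungen zur Verteilung der
  Primzahlen (Zweite Mitteilung)*, Math. Z. 6 (1920), 11–51. [HeckeMathZ1920]
-/

noncomputable section

open scoped MatrixGroups Topology InnerProductSpace NNReal
open NumberField IsDedekindDomain MeasureTheory Filter Polynomial

namespace Literature.NumberTheory.Automorphic

open AdelicGroupData GaloisRepresentations

/-! ### The Rankin–Selberg polynomial of two singletons -/

/-- The unramified Rankin–Selberg polynomial of two singletons: `P({a}, {b}; x) = 1 - a b x`
(`det(1 - t ⊗ t' x)` for `1 × 1` matrices; Jacquet–Shalika (1981), §2). [folklore] -/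
theorem eval_satakePairPolynomial_singleton (a b x : ℂ) :
    (satakePairPolynomial {a} {b}).eval x = 1 - a * b * x := by
  rw [satakePairPolynomial_eq_eulerPolynomial, show ({a} : Multiset ℂ) = a ::ₘ 0 from rfl,
    satakeTensor_cons_left, satakeTensor_zero_left, add_zero, Multiset.map_singleton,
    eval_eulerPolynomial_singleton]

/-! ### Products of Hecke characters at a finite place -/

/-- `(χψ)(ϖ_v) = χ(ϖ_v) ψ(ϖ_v)` (multiplication of Hecke characters is pointwise). [folklore] -/
theorem _root_.Literature.NumberTheory.GaloisRepresentations.HeckeCharacter.valueAtUniformizer_mul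
    {K : Type*} [Field K] [NumberField K] (χ ψ : HeckeCharacter K) (v : HeightOneSpectrum (𝓞 K)) :
    (χ * ψ).valueAtUniformizer v = χ.valueAtUniformizer v * ψ.valueAtUniformizer v := by
  simp only [HeckeCharacter.valueAtUniformizer, HeckeCharacter.localComponent_apply,
    HeckeCharacter.mul_apply, Units.val_mul]

/-- A product of characters unramified at `v` is unramified at `v`. [folklore] -/
theorem _root_.Literature.NumberTheory.GaloisRepresentations.HeckeCharacter.IsUnramifiedAt.mul
    {K : Type*} [Field K] [NumberField K] {χ ψ : HeckeCharacter K} {v : HeightOneSpectrum (𝓞 K)}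
    (hχ : χ.IsUnramifiedAt v) (hψ : ψ.IsUnramifiedAt v) : (χ * ψ).IsUnramifiedAt v := by
  intro u
  have h1 := hχ u
  have h2 := hψ u
  rw [HeckeCharacter.localComponent_apply] at h1 h2 ⊢
  rw [HeckeCharacter.mul_apply, h1, h2, one_mul]

/-! ### The eigencharacter of an irreducible `W ≤ L²(GL_1)` through its Hecke character -/

section EigenCharacter

variable {K : Type} [Field K] [NumberField K]
  {μ : Measure (gl 1 K).automorphicQuotient} [(gl 1 K).IsAutomorphicMeasure μ]
  {W W' : ContRepresentation.ClosedSubrep ((gl 1 K).rightRegular μ)}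

namespace GLOne

/-- `ω_W(g) = χ_W(det g)`: every `g ∈ GL_1(𝔸_K)` is the scalar matrix of the idele `det g`
(`generalLinearGroup_scalar_det_of_fin_one`), and `χ_W = ω_W ∘ scalar` by definition. [folklore] -/
theorem eigenvalue_eq_heckeCharacter_det (hW : W.toContRep.IsTopIrreducible)
    (g : (gl 1 K).Adelic) :
    eigenvalue hW g = ((heckeCharacter hW (Matrix.GeneralLinearGroup.det g) : ℂˣ) : ℂ) := by
  rw [coe_heckeCharacter_apply]
  exact congrArg (eigenvalue hW) (generalLinearGroup_scalar_det_of_fin_one g).symm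

/-- Irreducible `W, W' ≤ L²(GL_1)` with the same Hecke character have the same eigencharacter on
all of `GL_1(𝔸_K)`. [folklore] -/
theorem eigenvalue_eq_of_heckeCharacter_eq (hW : W.toContRep.IsTopIrreducible)
    (hW' : W'.toContRep.IsTopIrreducible) (h : heckeCharacter hW = heckeCharacter hW')
    (g : (gl 1 K).Adelic) : eigenvalue hW g = eigenvalue hW' g := by
  rw [eigenvalue_eq_heckeCharacter_det hW, eigenvalue_eq_heckeCharacter_det hW', h]

/-- `R(g) f = ω_W(g) f` in `L²` for `f ∈ W` (`toContRep_apply_eq_eigenvalue_smul`, unbundled).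
[folklore] -/
theorem rightRegular_apply_eq_eigenvalue_smul (hW : W.toContRep.IsTopIrreducible)
    (g : (gl 1 K).Adelic) {f : (gl 1 K).L2 μ} (hf : f ∈ W) :
    (gl 1 K).rightRegular μ g f = eigenvalue hW g • f :=
  congrArg Subtype.val (toContRep_apply_eq_eigenvalue_smul hW g ⟨f, hf⟩)

/-- **Same Hecke character ⟹ containment.** If the irreducible `W, W' ≤ L²(GL_1(K) A_G \ GL_1(𝔸_K))`
have the same Hecke character `χ`, then `W' ≤ W`: for `0 ≠ a ∈ W` and `b ∈ W'`, both
`χ ∘ det`-eigenfunctions of the regular representation, the component `b - (⟪a,b⟫/⟪a,a⟫) a` of `b`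
orthogonal to `a` is again a `χ ∘ det`-eigenfunction, hence `0` by ergodicity of `GL_1(𝔸_K)` on the
automorphic quotient (`AdelicGroupData.eq_zero_of_inner_eq_zero_of_rightRegular_apply_eq_smul`),
so `b ∈ ℂ a ⊆ W` (Gelbart (1975), proof of Thm. 10.10, the one-dimensional constituents).
[cite: Gelbart1975, Thm. 10.10 (proof)] -/
theorem le_of_heckeCharacter_eq (hW : W.toContRep.IsTopIrreducible)
    (hW' : W'.toContRep.IsTopIrreducible) (h : heckeCharacter hW = heckeCharacter hW') :
    W' ≤ W := by
  haveI : LocallyCompactSpace (gl 1 K).Adelic := locallyCompactSpace_gl_adelic_holds 1 K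
  haveI : SecondCountableTopology (gl 1 K).Adelic := secondCountableTopology_gl_adelic 1 K
  obtain ⟨a, ha0⟩ := exists_ne_zero hW
  have ha0' : (a : (gl 1 K).L2 μ) ≠ 0 := fun h0 => ha0 (Subtype.ext h0)
  have ha : ∀ g, (gl 1 K).rightRegular μ g (a : (gl 1 K).L2 μ) =
      eigenvalue hW g • (a : (gl 1 K).L2 μ) :=
    fun g => rightRegular_apply_eq_eigenvalue_smul hW g a.2
  intro b hb
  have hb' : ∀ g, (gl 1 K).rightRegular μ g b = eigenvalue hW g • b := fun g => by
    rw [eigenvalue_eq_of_heckeCharacter_eq hW hW' h g]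
    exact rightRegular_apply_eq_eigenvalue_smul hW' g hb
  set c₀ : ℂ := ⟪(a : (gl 1 K).L2 μ), b⟫_ℂ / ⟪(a : (gl 1 K).L2 μ), (a : (gl 1 K).L2 μ)⟫_ℂ with hc₀
  have hh : ∀ g, (gl 1 K).rightRegular μ g (b - c₀ • (a : (gl 1 K).L2 μ)) =
      eigenvalue hW g • (b - c₀ • (a : (gl 1 K).L2 μ)) := by
    intro g
    rw [map_sub, map_smul, ha g, hb' g, smul_sub, smul_comm]
  have horth : ⟪(a : (gl 1 K).L2 μ), b - c₀ • (a : (gl 1 K).L2 μ)⟫_ℂ = 0 := by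
    rw [inner_sub_right, inner_smul_right, hc₀, div_mul_cancel₀ _ (inner_self_ne_zero.2 ha0'),
      sub_self]
  have h0 := (gl 1 K).eq_zero_of_inner_eq_zero_of_rightRegular_apply_eq_smul μ ha hh ha0' horth
  rw [sub_eq_zero] at h0
  rw [h0]
  exact W.toSubmodule.smul_mem c₀ a.2

/-- **Multiplicity one for `GL_1`, unconditionally**: irreducible closed invariant subspaces
`W, W'` of `L²(GL_1(K) A_G \ GL_1(𝔸_K))` with the same Hecke character coincide (each is the line
spanned by a `χ`-eigenfunction, and `χ`-eigenfunctions are proportional by ergodicity;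
Gelbart (1975), Thm. 10.10, proof). In particular the hypothesis `multiplicity_one_gl 1 K μ` of
the Jacquet–Shalika facts is not needed in rank one. [cite: Gelbart1975, Thm. 10.10 (proof)] -/
theorem eq_of_heckeCharacter_eq (hW : W.toContRep.IsTopIrreducible)
    (hW' : W'.toContRep.IsTopIrreducible) (h : heckeCharacter hW = heckeCharacter hW') :
    W = W' := by
  have hle : W' ≤ W := le_of_heckeCharacter_eq hW hW' h
  have hnt : Nontrivial W'.toSubmodule := ((ContRepresentation.isTopIrreducible_iff _).mp hW').1
  exact (ContRepresentation.ClosedSubrep.eq_of_le_of_isTopIrreducible hW hnt hle).symm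

/-- **The eigencharacter of the conjugate is the conjugate eigencharacter**: `ω_{W̄}(g) =
\overline{ω_W(g)}`, because `R(g) f̄ = \overline{R(g) f} = \overline{ω_W(g) f} = \bar ω_W(g) f̄`
(`AdelicGroupData.rightRegular_conjL2`). [folklore] -/
theorem eigenvalue_conj (hW : W.toContRep.IsTopIrreducible) (g : (gl 1 K).Adelic) :
    eigenvalue (W.isTopIrreducible_conj_iff.mpr hW) g = starRingEnd ℂ (eigenvalue hW g) := by
  obtain ⟨f, hf0⟩ := exists_ne_zero hW
  have hf0' : (f : (gl 1 K).L2 μ) ≠ 0 := fun h0 => hf0 (Subtype.ext h0)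
  have hsf : star (f : (gl 1 K).L2 μ) ∈ W.conj := W.star_mem_conj f.2
  have hsf0 : star (f : (gl 1 K).L2 μ) ≠ 0 := fun h0 =>
    hf0' (norm_eq_zero.mp (by rw [← L2.norm_star, h0, norm_zero]))
  have h1 : (gl 1 K).rightRegular μ g (star (f : (gl 1 K).L2 μ)) =
      eigenvalue (W.isTopIrreducible_conj_iff.mpr hW) g • star (f : (gl 1 K).L2 μ) :=
    rightRegular_apply_eq_eigenvalue_smul _ g hsf
  have h2 : (gl 1 K).rightRegular μ g (star (f : (gl 1 K).L2 μ)) =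
      starRingEnd ℂ (eigenvalue hW g) • star (f : (gl 1 K).L2 μ) := by
    have h := (gl 1 K).rightRegular_conjL2 μ g (f : (gl 1 K).L2 μ)
    rw [conjL2_apply, conjL2_apply, rightRegular_apply_eq_eigenvalue_smul hW g f.2,
      L2.star_smul] at h
    exact h
  exact smul_left_injective ℂ hsf0 (h1.symm.trans h2)

/-- **`χ_{W̄} = χ_W⁻¹`**: the conjugate subrepresentation has the conjugate, i.e. (unitarity,
`|χ_W| = 1`) the inverse, Hecke character — `π̄ ≅ π̃` for unitary `π` (Arthur–Clozel (1989),
Ch. 3 §2: "`σ̃`, the contragredient of `σ`"). [folklore] -/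
theorem heckeCharacter_conj (hW : W.toContRep.IsTopIrreducible) :
    heckeCharacter (W.isTopIrreducible_conj_iff.mpr hW) = (heckeCharacter hW)⁻¹ := by
  refine HeckeCharacter.ext fun x => Units.ext ?_
  rw [coe_heckeCharacter_apply, eigenvalue_conj hW, ← coe_heckeCharacter_apply,
    HeckeCharacter.inv_apply, Units.val_inv_eq_inv_val,
    Complex.inv_eq_conj (isUnitary_heckeCharacter hW x)]

/-- **`χ_W` is trivial on `A_G = ℝ_{>0}`** (the positive real ideles `z(t)`, diagonal at infinity):
`scalar (z(t)) = posRealScalar t ∈ A_G ≤ A_G · GL_1(K)`, on which the eigencharacter is `1`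
(`eigenvalue_eq_one_of_mem_quotientSubgroup`; outline D10: the quotient is by `A_G GL_1(K)`).
[folklore] -/
theorem heckeCharacter_posRealIdele (hW : W.toContRep.IsTopIrreducible) (t : ℝ≥0ˣ) :
    heckeCharacter hW (posRealIdele K t) = 1 := by
  refine Units.ext ?_
  rw [coe_heckeCharacter_apply, Units.val_one]
  exact eigenvalue_eq_one_of_mem_quotientSubgroup hW
    ((gl 1 K).center'_le_quotientSubgroup (MonoidHom.mem_range.mpr ⟨t, rfl⟩))

end GLOne

/-! ### Cuspidal automorphic representations of `GL_1` -/

namespace CuspidalAutomorphicRepGL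

/-- **Multiplicity one for `GL_1`**: cuspidal automorphic representations `π, π'` of `GL_1(𝔸_K)`
(in the same `L²_cusp`) with the same Hecke character are equal as subspaces
(`GLOne.eq_of_heckeCharacter_eq`; Gelbart (1975), Thm. 10.10, proof).
[cite: Gelbart1975, Thm. 10.10 (proof)] -/
theorem eq_of_heckeCharacter_eq {P Q : CuspidalAutomorphicRepGL 1 K μ}
    (h : P.heckeCharacter = Q.heckeCharacter) : P = Q :=
  Subtype.ext (GLOne.eq_of_heckeCharacter_eq P.isTopIrreducible Q.isTopIrreducible h)

/-- **`χ_{π̄} = χ_π⁻¹`** for a cuspidal `π : GL_1` (`GLOne.heckeCharacter_conj`): the conjugate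
`π̄` of `AutomorphicConjugate` realises the contragredient `π̃ = χ_π⁻¹`. [folklore] -/
theorem heckeCharacter_conj (P : CuspidalAutomorphicRepGL 1 K μ) :
    P.conj.heckeCharacter = P.heckeCharacter⁻¹ :=
  GLOne.heckeCharacter_conj P.isTopIrreducible

/-- `χ_π(z(t)) = 1` for `t > 0`: the Hecke character of a cuspidal `π : GL_1` is trivial on
`A_G = ℝ_{>0}` (`GLOne.heckeCharacter_posRealIdele`). [folklore] -/
theorem heckeCharacter_posRealIdele (P : CuspidalAutomorphicRepGL 1 K μ) (t : ℝ≥0ˣ) :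
    P.heckeCharacter (posRealIdele K t) = 1 :=
  GLOne.heckeCharacter_posRealIdele P.isTopIrreducible t

/-- **The partial Rankin–Selberg `L`-function of two cuspidal `π, π' : GL_1` is the partial Hecke
`L`-function of `χ_π χ_{π'}`:** for honest Satake families `α`, `β` of `π`, `π'` off `S`,
`L^S(s, π × π') = ∏'_{v ∉ S} (1 - χ_π(ϖ_v) χ_{π'}(ϖ_v) q_v^{-s})⁻¹ = ∏'_{v ∉ S} (1 - (χ_π χ_{π'})(ϖ_v) q_v^{-s})⁻¹`
(all `s`; both sides the same `tprod`), by the `GL_1` dictionary `α v = {χ_π(ϖ_v)}`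
(`IsSatakeFamilyOf.eq_singleton_valueAtUniformizer`). [folklore] -/
theorem partialPairL_eq_tprod_heckeCharacter {P P' : CuspidalAutomorphicRepGL 1 K μ}
    {S : Set (HeightOneSpectrum (𝓞 K))} {α β : SatakeFamily K} (hα : IsSatakeFamilyOf P S α)
    (hβ : IsSatakeFamilyOf P' S β) (s : ℂ) :
    partialPairL S α β s = ∏' v : {v : HeightOneSpectrum (𝓞 K) // v ∉ S},
      (1 - (P.heckeCharacter * P'.heckeCharacter).valueAtUniformizer v.1 *
        ((v.1.residueCard : ℂ) ^ (-s)))⁻¹ := by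
  unfold partialPairL
  refine tprod_congr fun v => ?_
  rw [hα.eq_singleton_valueAtUniformizer v.2, hβ.eq_singleton_valueAtUniformizer v.2,
    eval_satakePairPolynomial_singleton, HeckeCharacter.valueAtUniformizer_mul]

/-- Off `S`, the product character `χ_π χ_{π'}` is unramified. [folklore] -/
theorem isUnramifiedAt_heckeCharacter_mul {P P' : CuspidalAutomorphicRepGL 1 K μ}
    {S : Set (HeightOneSpectrum (𝓞 K))} {α β : SatakeFamily K} (hα : IsSatakeFamilyOf P S α)
    (hβ : IsSatakeFamilyOf P' S β) {v : HeightOneSpectrum (𝓞 K)} (hv : v ∉ S) :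
    (P.heckeCharacter * P'.heckeCharacter).IsUnramifiedAt v :=
  (hα.isUnramifiedAt_heckeCharacter hv).mul (hβ.isUnramifiedAt_heckeCharacter hv)

/-- `π ≠ π̄'` (as subspaces of `L²_cusp(GL_1)`) forces `χ_π χ_{π'} ≠ 1`: otherwise
`χ_{π̄'} = χ_{π'}⁻¹ = χ_π` and `π = π̄'` by multiplicity one for `GL_1`
(`eq_of_heckeCharacter_eq`). This is "`π ≇ σ̃`" of Arthur–Clozel (2.2) in rank one. [folklore] -/
theorem heckeCharacter_mul_ne_one {P P' : CuspidalAutomorphicRepGL 1 K μ} (hne : P ≠ P'.conj) :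
    P.heckeCharacter * P'.heckeCharacter ≠ 1 := by
  intro h1
  apply hne
  refine eq_of_heckeCharacter_eq ?_
  rw [heckeCharacter_conj, ← mul_eq_one_iff_eq_inv.mp h1]

end CuspidalAutomorphicRepGL

/-! ### The reduction of (2.2) at `s = 1`, `n = 1`, to Hecke `L`-functions -/

/-- **Arthur–Clozel (2.2) at `s = 1` in rank one, from Hecke–Landau.** Hypothesis `h` (the
classical theorem, in the tree's limit rendering): for every unitary Hecke character `ψ` of `K`
trivial on `A_G = ℝ_{>0}` with `ψ ≠ 1`, and every finite set `S` of finite places off which `ψ` is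
unramified, the partial Hecke `L`-function `L^S(s, ψ) = ∏'_{v ∉ S} (1 - ψ(ϖ_v) q_v^{-s})⁻¹` has a
finite non-zero limit as `s → 1`, `Re s > 1` (Hecke (1920): continuation of `L(s, ψ)`, entire for
`ψ` not a norm twist — Tate (1950), Thm. 4.4.1 —, and `L(1 + it, ψ) ≠ 0`; for `K = ℚ`:
Dirichlet). Conclusion: `JacquetShalika1981_partialPairL_at_one_of_ne_conj` for `n = 1` over `K`:
for cuspidal `π, π' ≤ L²_cusp(GL_1(K) A_G \ GL_1(𝔸_K))` with `π ≠ π̄'` and honest Satake families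
off a finite `S`, `L^S(s, π × π')` has a finite non-zero limit at `s = 1` from `Re s > 1`. Proof:
`L^S(s, π × π') = L^S(s, χ_π χ_{π'})` (`partialPairL_eq_tprod_heckeCharacter`), `ψ = χ_π χ_{π'}` is
unitary, trivial on `A_G`, unramified off `S`, and `≠ 1` (`heckeCharacter_mul_ne_one`, i.e.
`π ≇ π̃' = π̄'` by multiplicity one for `GL_1`, proved — the hypothesis `multiplicity_one_gl` is not
used). [cite: ArthurClozelAMS120, Ch. 3 §2 (2.2)] -/
theorem JacquetShalika1981_partialPairL_at_one_of_ne_conj_one_of_heckeCharacter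
    (h : ∀ (ψ : HeckeCharacter K) (_hu : ψ.IsUnitary) (_hA : ∀ t : ℝ≥0ˣ, ψ (posRealIdele K t) = 1)
      (_h1 : ψ ≠ 1) {S : Set (HeightOneSpectrum (𝓞 K))} (_hS : S.Finite)
      (_hur : ∀ v ∉ S, ψ.IsUnramifiedAt v),
      ∃ c : ℂ, c ≠ 0 ∧ Tendsto (fun s : ℂ => ∏' v : {v : HeightOneSpectrum (𝓞 K) // v ∉ S},
        (1 - ψ.valueAtUniformizer v.1 * ((v.1.residueCard : ℂ) ^ (-s)))⁻¹)
        (𝓝[{s : ℂ | 1 < s.re}] 1) (𝓝 c)) :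
    JacquetShalika1981_partialPairL_at_one_of_ne_conj (n := 1) (K := K) (μ := μ) := by
  intro _ _ P P' hne S hS α β hα hβ
  obtain ⟨c, hc, hlim⟩ := h (P.heckeCharacter * P'.heckeCharacter)
    (P.isUnitary_heckeCharacter.mul P'.isUnitary_heckeCharacter)
    (fun t => by rw [HeckeCharacter.mul_apply, P.heckeCharacter_posRealIdele,
      P'.heckeCharacter_posRealIdele, one_mul])
    (CuspidalAutomorphicRepGL.heckeCharacter_mul_ne_one hne) hS
    (fun v hv => CuspidalAutomorphicRepGL.isUnramifiedAt_heckeCharacter_mul hα hβ hv)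
  refine ⟨c, hc, ?_⟩
  have hfun : partialPairL S α β = fun s : ℂ => ∏' v : {v : HeightOneSpectrum (𝓞 K) // v ∉ S},
      (1 - (P.heckeCharacter * P'.heckeCharacter).valueAtUniformizer v.1 *
        ((v.1.residueCard : ℂ) ^ (-s)))⁻¹ :=
    funext (CuspidalAutomorphicRepGL.partialPairL_eq_tprod_heckeCharacter hα hβ)
  rw [hfun]
  exact hlim

end EigenCharacter

end Literature.NumberTheory.Automorphic
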